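import Mathlib
import HarnessLib
import HarnessLib.Audit
import Summits.AtomisticToContinuum.Statement
import Literature.MathematicalPhysics.KineticTheory.LangevinChainGibbs
import Literature.MathematicalPhysics.KineticTheory.LangevinChainNESSHolds
import Summits.AtomisticToContinuum.FouriersLaw.Theorems.EmbeddedDrudeMourreNessUnique
import HarnessLib.Audit.Status.Attr

/-!
Route: ContactStieltjesMeasure

# Route ContactStieltjesMeasure — friction as spectral parameter — FL is equidistribution of one
γ-free contact measure

X (CONTACT STIELTJES MEASURE; realises card contact-stieltjes-foster-equidistribution, critic-graded
new-mechanism 2026-08-16, not yet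
routed). Fix pinnedChain ω₂ lam β (all > 0) and T > 0 and let G_N(γ) := D_N(γ)/(N−1) be BLR's
two-terminal linear-response conductance of
the N-site chain with bath friction γ. The bath friction enters the generator L_γ = A − γP linearly
and positively (A the Liouvillian,
skew; P ≥ 0 the γ-FREE Ornstein–Uhlenbeck number operator of p_0, p_{N−1}), so treating γ as the
SPECTRAL PARAMETER gives, at every fixed
N ≥ 2, ONE bounded monotone γ-free contact distribution function Φ_N (Φ_N(s) = μ̂_N((0,s]), μ̂_N the
contact spectral measure) with
G_N(γ) = γ∫₀^∞ Φ_N(t)·2t/(γ²+t²)² dt = γ∫dμ̂_N(s)/(γ²+s²) for ALL γ > 0 (K2 =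
StieltjesRepresentation). It suffices to show X := K2 ∧
(U) ContactUpperDensity: N·Φ_N(t) ≤ C(1+t) eventually in N (anti-ballistic) ∧ (M)
ContactMeasureLimit: N·Φ_N(t) → M(t) at the continuity
points of a monotone M (existence) ∧ (P) ConductanceLowerBound (shared stmt-11749, positivity). Then
D_N(γ) → κ(T) := γ∫₀^∞ M(t)·2t/(γ²+t²)²dt
> 0 by dominated convergence — the deciding theorem `closes : StieltjesRepresentation →
ContactUpperDensity → ContactMeasureLimit →
ConductanceLowerBound → FouriersLaw` is PROVED (crux-only hypotheses; weak-NESS uniqueness stmt-0741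
is PROVED in the tree and invoked
inside the proof, the finite response is part of K2; sorry-free, axioms
propext/Classical.choice/Quot.sound).
Lean: `StieltjesRepresentation ∧ ContactUpperDensity ∧ ContactMeasureLimit ∧ ConductanceLowerBound`

## Assembly
Real analysis only, PROVED in glue.lean as `theorem closes (hRep : StieltjesRepresentation) (hUD :
ContactUpperDensity)
(hLim : ContactMeasureLimit) (hP : ConductanceLowerBound) : _root_.FouriersLaw` (crux-only
hypotheses; lean check rc 0, no sorry, no
warnings, axioms propext/Classical.choice/Quot.sound). Fix parameters; clause (i) =
pinnedChain_exists_isSteadyState (proved, N = 0 included) +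
the proved Theorems.nessUnique_proof (stmt-0741). Clause (ii): canonical family μ₀ by
Classical.choose; Φ_N from K2 (one family for all
N ≥ 2); D_N := (N−1)γ∫Φ_N·w_γ for N ≥ 2 (its δ-limit statement IS K2) and D_N := 0 for N ≤ 1 (no
bonds, the quotient vanishes identically);
(U) gives C, N₀, (M) gives M; D_N = γ·((N−1)/N)·∫(NΦ_N)·w_γ with w_γ(t) = 2t/(γ²+t²)²; dominated
convergence on (0,∞)
(majorant C(1+t)w_γ(t) ≤ C(3+2/γ²+1/γ⁴)(1+t²)⁻¹, `integrable_inv_one_add_sq`; a.e. convergence off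
the countable jump set of M,
`Monotone.countable_not_continuousAt`) gives D_N → γ∫M·w_γ =: κ(T); ConductanceLowerBound gives κ(T)
≥ c > 0 (ge_of_tendsto); uniqueness
transfers the δ-limits to every steady-state family (Filter.Tendsto.congr').

Rationale: WHY THIS LINE. Every open FouriersLaw route works in the time/frequency variable of a current or
boundary observable at FIXED bath coupling; none uses the
one knob that touches neither H nor μ_T. Because γ multiplies a positive operator, Sym((γP+A)⁻¹) =
γ(γP+A)⁻¹P(γP−A)⁻¹ and an ε-regularisation
of P on its kernel make γ ↦ G_N(γ)/γ a Stieltjes transform in γ² of one positive measure (the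
analytic-continuation / integral-representation
method of homogenisation: Bergman–Milton, GoldenPapanicolaou1983, Avellaneda–Majda
doi:10.1007/BF02099496 — there in a material contrast or a
molecular diffusivity, never in the friction of a boundary-driven Hamiltonian chain). In this arena
the transport class is the SHAPE of μ̂_N
(ballistic ⟺ bounded support — the harmonic delimiter, RLL/HarmonicChainBallisticFlux; insulator ⟺
mass escaping beyond s ≍ N; Fourier ⟺
N·μ̂_N equidistributes at density 2κ/π), so the N → ∞ problem becomes a local-density /
vague-convergence problem for ONE sequence of positive
measures attached to an explicit skew pencil (P^{-1/2}ÃP^{-1/2}, Ã the Schur compression of the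
Liouvillian onto the bath-visible sector, whose
large spectral values are the small denominators of the ISOLATED interior chain with Gibbs-random
frozen walls), where LDOS tools (Wegner-type
averaging over the frozen-wall randomness, commutator/Mourre bounds for the pencil, Stieltjes–Vitali
transfer in γ, exact finite-N Hausdorff
inequalities) replace decay-of-correlation estimates; it also yields new N-uniform finite-N theorems
for free (CouplingFreeCeiling, oddness,
weak-coupling atom). Sources: BonettoLebowitzReyBellet2000 §5.3 (33), §6.2; KunduDharNarayan2009
(open-chain Kubo); BernardinOlla2011 eq. (var);
doi:10.1038/srep17506 (harmonic turnover phenomenology); CuneoEckmannHairerReyBellet2018 Thm 2.13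
and Carmona2007 (fixed-N theory for K2).
Negatives index (FouriersLaw): OddCorrectorDecay and FarFieldGaussianity refutations are not used or
restated.

RANKED CRUXES. #2 ContactUpperDensity (crux) — (U) ANTI-BALLISTIC HALF in contact currency (card K1,
upper density): for pinnedChain (all > 0) and T > 0, for every family of contact distribution
functions Φ_N representing the response at every γ (the data of K2), there are C and N₀ with
N·Φ_N(t) ≤ C·(1+t) for all N ≥ N₀ and all t > 0 — the scaled contact measure N·μ̂_N has O(1)
cumulative density at EVERY scale; by the layer-cake form it gives HasBoundedResponse at every γ
(N·G_N(γ) ≤ C·γ·(3+2/γ²+1/γ⁴)·π/2) and it is the conductance plateau 'G_N(γ) ≈ κ/N for κ/N ≪ γ ≪ N'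
made uniform. [deps: StieltjesRepresentation] [difficulty: open-problem] (why it might fail: It IS
the finiteness content (false at lam=β=0: bounded support ⇒ N·Φ_N(1) ≍ N) and slightly stronger than
bounded response: a mass bump of N·μ̂_N at scales 1 ≪ t ≪ N (a band of interior relaxation rates)
breaks it while FL survives; C(T) ≳ (lam·T)⁻².) [BonettoLebowitzReyBellet2000,
AokiLukkarinenSpohn2006, BeckerMenegaki2022, doi:10.1038/srep17506, decl
Literature.Barriers.AtomisticToContinuum.HasBoundedResponse]
#3 StieltjesRepresentation (crux) — (K2) THE REPRESENTATION (card K2 + layer cake), stated for ω₂ >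
0, lam ≥ 0, β ≥ 0 (the harmonic member INCLUDED: there it is a finite-atom step function, a
Lean-sized calibration against HarmonicChainBallisticFlux) and T > 0: there is a family (Φ_N)_{N≥2}
of bounded monotone functions vanishing on (−∞,0] (the contact distribution functions s ↦
μ̂_N((0,s]), ONE per N) such that for EVERY friction γ > 0, under weak-NESS uniqueness and for every
steady-state family, the response quotient totalCurrent(μ_{N,T+δ/2,T−δ/2})/δ CONVERGES (δ → 0) to
(N−1)·γ·∫₀^∞ Φ_N(t)·2t/(γ²+t²)² dt (= (N−1)·γ∫dμ̂_N/(γ²+s²)) — existence of the finite-N response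
(known, KDN/0717) and its Stieltjes identification in one clause. Proof core: G_N(γ) = γ/2 −
(γ²/4T²)⟨u,(γP+A)⁻¹u⟩, u = p_0² − p²_{N−1}; Sym((γP+A)⁻¹) = γ(γP+A)⁻¹P(γP−A)⁻¹; P_ε = P + εΠ_0, 𝕂_ε
= P_ε^{-1/2}AP_ε^{-1/2} skew ⇒ ⟨v,(γ+𝕂_ε)⁻¹v⟩ = γ⟨v,(γ²+|𝕂_ε|²)⁻¹v⟩; the constant term 1/2 −
‖P^{-1/2}u‖²/4T² vanishes exactly (Var p_b² = 2T²); pointwise limits of Stieltjes transforms of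
fixed mass; μ̂ = s²ρ/4T² kills the atom (reflection-odd invariant structure of the isolated chain).
[difficulty: L] (why it might fail: Fixed-N but real: ∂_δJ must equal the L²(μ_T) resolvent form at
spectral parameter 0 for EVERY γ>0 (weighted-space ergodic theory of the hypoelliptic generator,
core on C_c^∞), uniformly enough for ε→0; KAM-slow isolated-chain structure at small γ could spoil
'D = formula' there.) [CuneoEckmannHairerReyBellet2018, Carmona2007, KunduDharNarayan2009,
BernardinOlla2011, ReyBellet2003, HairerMajda2009, GoldenPapanicolaou1983, doi:10.1007/BF02099496]
#4 ContactMeasureLimit (crux) — (M) EXISTENCE HALF in contact currency (card K1, convergence): for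
every representing family Φ_N there is a monotone M : ℝ → ℝ with N·Φ_N(t) → M(t) at every continuity
point t > 0 of M — the scaled contact measures N·μ̂_N converge vaguely on (0,∞) (under FL with flat
density, M(t) = 2κt/π: support ContactEquidistribution). With (U) and K2, dominated convergence
gives D_N(γ) → γ∫₀^∞M(t)·2t/(γ²+t²)²dt for every γ simultaneously. [deps: StieltjesRepresentation]
[difficulty: open-problem] (why it might fail: Given K2,(U) it is equivalent to convergence of
D_N(γ) for ALL γ at once (Stieltjes–Vitali): the existence clause of FL uniformly in the coupling;
two subsequences with different contact profiles (parity in N, an IR edge drifting like (κ/N)·log N)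
break it.) [BonettoLebowitzReyBellet2000, KunduDharNarayan2009, doi:10.1007/BF02099496, Dhar2008]
#5 ConductanceLowerBound (crux) — (P) NOT INSULATING (shared item stmt-AtomisticToContinuum-11749,
verbatim): under weak-NESS uniqueness, for every steady-state family, T > 0 and response
coefficients D_N: ∃ c > 0, N₁ with c ≤ D_N for all N ≥ N₁. In contact currency: N·μ̂_N does not
vanish vaguely (some mass c' stays below a fixed scale S); in `closes` it makes κ(T) = γ∫M·w_γ ≥ c >
0. [difficulty: open-problem] (why it might fail: No N-uniform lower bound on the NESS current of a
deterministic anharmonic chain is in print; asymptotic localisation (DeRoeckHuveneers2015) makes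
c(T) super-polynomially small at large lam·T; in contact currency all mass may escape to s ≫ N.)
[DeRoeckHuveneers2015, BonettoLebowitzReyBellet2000, BernardinOlla2011, Dhar2008]
#9 ContactEquidistribution (support) — THE SHARP FORM (card K1 verbatim: equidistribution): for
every representing family, N·Φ_N(t) → (2κ/π)·t for all t > 0 with some κ > 0 — the scaled contact
measures converge vaguely to (2κ/π)·Lebesgue; implies (M) with M(t) = 2κt/π and, with (U),
FouriersLaw with a γ-INDEPENDENT κ (γ∫(2κ/π)ds/(γ²+s²) = κ); not a hypothesis of `closes` (the
Statement lets κ depend on γ), filed for provers/refuters of the flat-density prediction.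
[difficulty: open-problem] [BonettoLebowitzReyBellet2000, doi:10.1007/BF02099496,
doi:10.1038/srep17506]
#9 CouplingFreeCeiling (support) — FINITE-N COROLLARY of the K2 construction (card P1), N-uniform
and new, stated for lam, β ≥ 0: for all N ≥ 2, T > 0 and EVERY γ > 0, G_N(γ) = D_N/(N−1) ≤
γm/(γ²+2m) (≤ ¼√(2m) = ¼√E[U″(q_0)+V″(q_1−q_0)], coupling-free), with m :=
½E_{μ_T}[U″(q_0)+V″(q_1−q_0)] = ½E[ω₂+3lam q_0²+1+3β(q_1−q_0)²] (mass of μ̂_N ≤ m by ‖𝕂v‖² = 2T E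
F_0² and Gibbs integration by parts; ∫dμ̂/s² ≤ ½; two-constraint Chebyshev bound with tangent at s²
= 2m). Checked against the harmonic dimer: γ/(2+4γ²) ≤ γ/(γ²+2) at ω₂ = 1. A refutable N-uniform
inequality that is false for no known chain; Lean-provable once the (S)-construction lands.
[difficulty: M] [BonettoLebowitzReyBellet2000, RiederLebowitzLieb1967, doi:10.1038/srep17506]

TWO-LAYER PLAN. K2 ⇐ ResolventResponseFormula (∂_δ J at δ=0 equals γ/2 − (γ²/4T²)⟨u,(γP+Ā)⁻¹u⟩ in
L²(μ_T), all γ; generator core + weighted gap, shared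
technology with GeneratorCore stmt-13422) → StieltjesLimit (ε-regularised pencil, Stieltjes form, ε
→ 0, layer cake) → K2. (U) ⇐ ContactLDOSBound
(Wegner-type bound: the Gibbs-random frozen walls q_0, q_{N−1} of the isolated interior average the
small denominators of A_00 seen through
A_{+0}A_00⁻¹A_{0+}: N·μ̂_N([k,k+1]) ≤ C uniformly in k) → PlateauUniformity → (U). (M) ⇐
StieltjesCauchy (convergence of N·G_N(γ)/γ on a
γ-set with an accumulation point; Vitali) → VagueIdentification → (M). Nothing here is filed now.

KILL CRITERIA. K2 false at any finite N (a computed G_N(γ)/γ of pinnedChain that is not completely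
monotone in γ², or an even power in the weak-coupling
expansion) kills the line outright: close refuted:StieltjesRepresentation. ¬(U) by a mass bump at 1
≪ t ≪ N with FL intact ⇒ restate (U) in
the weighted form limsup_N N∫(1+t²)⁻¹dμ̂_N < ∞ (pure bounded response) — a pivot, not a death; ¬(U)
by ballistic mass at t = O(1) or ¬(P)
(all mass escaping) refutes the conjunct itself (file ¬FouriersLaw with the witness). ¬(M) with
(U),(P) true means D_N(γ) oscillates: FL false.
CouplingFreeCeiling violated numerically for pinnedChain ⇒ the (S)-construction is wrong ⇒ close. If
FourierGreenKubo / StaticAbelianSqueeze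
close their residual (0742/13416) first, this route is superseded for the Statement but K2 +
CouplingFreeCeiling stay as finite-N theorems.

NOT DECOMPOSED YET. The LDOS engine for (U) (deliberately: it is the new open problem this arena
poses — candidate tools named in the Two-layer plan); the
ε → 0 bookkeeping and the resolvent/response identification inside K2 (shared fixed-N technology:
GeneratorCore 13422, GibbsKernelInvariant
13421, KuboAbelIdentity proved); the IR-edge law (N·μ̂_N below s ≍ κ/N, fixed by ∫dμ̂/s² = ½ − atom)
and the UV edge s ≍ N (needed only for
ContactEquidistribution's constant, not for `closes`); γ-independence of κ (support
ContactEquidistribution); the resistance-side twin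
ρ_N(γ) = γ/m̂_eff + 2/γ + γ∫dν_N/(γ²+t) ('Matthiessen made spectral') and the two-variable Pick
function in (λ, γ) joining this route to
BoundaryEscapeDeficit — recorded, not filed.

CHEAPEST FALSIFIER. Complete monotonicity at the solvable member: for lam = β = 0 the representation
forces z ↦ G_N(√z)/√z AND z ↦ (γ/2 − G_N)/γ³ to be completely
monotone in z = γ². RUN this session (compute/harmonic_foster_check.py, exact rational arithmetic,
4N²-dimensional Lyapunov equation of the
pinned harmonic chain ω₂ = 1, N = 2,3,4,5, eleven frictions γ ∈ [1/8, 8]): every divided difference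
up to order 10 has the sign (−1)^k —
PASS for both functions and all N; the N = 2 closed form G_2(γ) = γ/(2+2(ω₂+1)γ²) (one atom at s² =
1/(ω₂+1), mass 1/(2(ω₂+1)), saturating
∫dμ̂/s² = ½) is reproduced exactly; the card's own runs (RLL closed form CM to order 12; finite-N
operator identity to 3·10⁻¹¹, kit
j000824/j000924) agree. Next cheapest (refuters, kit): BAOAB NEMD of pinnedChain 1 1 1 γ, N ∈
{2,3,6}, γ-scan — oddness/CM of G_N(γ)/γ and the
ceiling G_N ≤ γm/(γ²+2m); one sign failure kills K2.

NUMBERS. Harmonic pinned chain ω₂ = 1 (this session, exact): G_2(1) = 1/6, G_3(1) = 3/22, G_4(1) ≈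
0.1279, G_5(1) ≈ 0.1257 (ballistic plateau
≈ 0.125·…, RLL); weak coupling G_N(1/8)/ (1/8) = 0.485, 0.478, 0.471, 0.465 (→ ½ − atom); ceiling at
ω₂ = 1, m = 1: G ≤ γ/(γ²+2) = 1/3 at γ = 1
(actual ≤ 1/6). Flat-density dictionary: N·μ̂_N ≈ (2κ/π)ds on [4κ/(πN), πNm̂/(2κ)], so N·G_N(γ) ≈ κ
on the plateau κ/N ≪ γ ≪ Nm̂/κ, G_N ≈ γ/2
below, ≈ m̂/γ above (doi:10.1038/srep17506 turnover). Open harmonic chain L² gap ≍ N⁻³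
(BeckerMenegaki2022) — unused. Items: 7
(4 cruxes, 2 supports, 1 assembly) + proved crux-only `closes`.

DEFINITION REQUESTS. None at open: Φ_N is quantified, not named (K2 existential; (U),(M) universal
over representing families — the representing Φ is unique a.e. by
Stieltjes inversion). If a grounder prefers named notions: `contactDistribution N T : ℝ → ℝ`
(right-continuous version) and
`twoTerminalConductance` next to LangevinChainNESS — pure abbreviations; the card's D1
(ContactSpectralMeasure via Bernstein) is the same object.

Novelty: Searches (2026-08-16, this seat; local searchd down — connection reset ×3, openalex/S2 HTTP 429):
`lit search --source crossref "thermal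
conductance coupling strength heat bath oscillator chain turnover"` (12 rows: Liu–Wang–Wang–Ren PRE
99 032114 strong system-bath coupling NDTC;
Ming–Li–Ding PRE 93 032127; Lindenberg–Cortés 1984 — physics of coupling dependence, no
representation); `lit galaxy search "dependence of the
heat current on the coupling" --star all` (0/0/0); `lit galaxy search "as a function of the bath
coupling" --star all` (2 pdf, unrelated);
`lit galaxy search --star pdf --mode bm25 "heat current depends on the coupling to the reservoirs"`
(15: Netz PRE 101 022120 harmonic NESS,
quantum-dot theses, MD — none with a Stieltjes/positive-real structure); in-hub: all 35 open route
files' levers (NOTES lever table), the 22 open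
+ 88 closed card titles, the card's own search log (Velizhanin et al. doi:10.1038/srep17506 read;
Avellaneda–Majda doi:10.1007/BF02099496;
GoldenPapanicolaou1983; BernardinOlla2011 eq. (var); gamma-parity card) and the mechanism critic's
legs (2026-08-16T00:21Z: 'no on-problem
precedent nameable').
Nearest prior art found: doi:10.1007/BF02099496 (Avellaneda–Majda 1991: effective diffusivity as a
Stieltjes function of the molecular
diffusivity, Padé bounds) and GoldenPapanicolaou1983 (effective conductivity Stieltjes in the
contrast) — the tool, on other problems;
doi:10.1038/srep17506 (harmonic turnover γ/2 ↔ 1/γ, Casher–Lebowitz formula impli  [refs: 10.1038/srep17506, 10.1007/BF02099496, doi:10.1038/srep17506, doi:10.1007/BF02099496, GoldenPapanicolaou1983, BernardinOlla2011]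

Barriers (technique_class: dissipation-as-spectral-parameter, stieltjes-equidistribution): - technique_class: dissipation-as-spectral-parameter, stieltjes-equidistribution
- Literature.Barriers.AtomisticToContinuum.HasBoundedResponse: it does not evade it; the bet is the
currency — the barrier's content is isolated as crux (U) in density form (slightly stronger,
refutable by bumps), to be attacked by LDOS bounds for an explicit pencil rather than by decay of
correlations; K2, CouplingFreeCeiling and `closes` claim nothing about N-dependence beyond that.
- Literature.Barriers.AtomisticToContinuum.HarmonicChainBallisticFlux: USED as the delimiter — at
lam = β = 0 the contact measure has bounded support (checked exactly, N ≤ 5), (U) fails as it must,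
and any proof of (U) has to push mass to s ≍ N using lam, β > 0; consistent with
LowTemperatureWeakAnharmonicity (C(T) ≳ (lam·T)⁻²).
- Literature.Barriers.AtomisticToContinuum.LowTemperatureWeakAnharmonicity: conceded — (U)'s
constant must blow up in the kinetic corner; the representation itself is T-uniform.
- Literature.Barriers.AtomisticToContinuum.BeckerMenegaki2022_gapClosing: evaded — no spectral gap,
mixing rate or hypocoercive constant of the open chain enters (G_N is a zero-frequency object in γ;
the N⁻³ gap of the harmonic chain coexists with a perfectly regular bounded-support μ̂_N).
- Literature.Barriers.AtomisticToContinuum.Mazur1969_inequality: represented inside the object, not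
assumed away — an odd conserved quantity is non-escaping mass (ballistic branch, ¬(U)); at finite N
reflection-odd invariant struct

History (route lifecycle, newest last):
- 2026-08-16T14:54:18Z · rev 1: restated StieltjesRepresentation (stmt-AtomisticToContinuum-15172), ContactUpperDensity (stmt-AtomisticToContinuum-15171), ContactMeasureLimit (stmt-AtomisticToContinuum-15173), ContactEquidistribution (stmt-AtomisticToContinuum-15176), Assembly (stmt-AtomisticToContinuum-15181) — crux-only repair of glue.non-cr (planner-plan-novel-AtomisticToContinuum-Fourier-51cdba3b-g2-)
- 2026-08-16T14:54:18Z · rev 1: dropped NessUnique, FiniteResponseOfUnique — crux-only repair of glue.non-crux-hypothesis (D-0027 §2.1): NessUnique (0741, PROVED: Theorems.nessUnique_proof) is invoked inside `closes`, module imported; th (planner-plan-novel-AtomisticToContinuum-Fourier-51cdba3b-g2-)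
- 2026-08-26T09:02:58Z · DORMANT — reconciler: no traction for 8.4 d (last activity item-evidence-added at 2026-08-17T22:55:48Z); parked, not closed — `ledger route dormant route-AtomisticToConti (operator:999:2778562)
- 2026-08-31T00:44:53Z · REACTIVATED (open) — reconciler: reactivated — activity statement-checked at 2026-08-30T23:27:57Z after parking at 2026-08-26T09:02:58Z (operator:999:1376863)

sub-problem: FouriersLaw · status: open · opened planner-plan-novel-AtomisticToContinuum-Fourier-51cdba3b-g2-0 2026-08-16T14:47:30Z · rev 2 · ledger route-AtomisticToContinuum-ContactStieltjesMeasure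
GENERATED by the gate from the ledger (D-0016/17). Provers cite these decls: `theorem foo : Summit.AtomisticToContinuum.FouriersLaw.Theses.ContactStieltjesMeasure.<Decl> := …` in Summits/AtomisticToContinuum/FouriersLaw/Theorems/<Name>.lean.
-/

namespace Summit.AtomisticToContinuum.FouriersLaw.Theses.ContactStieltjesMeasure

open scoped BigOperators Topology Manifold Classical MeasureTheory ProbabilityTheory Matrix InnerProductSpace ComplexConjugate ContinuousMap
open Filter Set Function TopologicalSpace MeasureTheory

attribute [summit_statement] _root_.FouriersLaw

-- earlier ContactUpperDensity (stmt-AtomisticToContinuum-15171, replaced 2026-08-16T14:54:18Z -> stmt-AtomisticToContinuum-15249): retired by None — ∀ ω₂ lam β : ℝ, 0 < ω₂ → 0 < lam → 0 < β → ∀ T : ℝ, 0 < T → ∀ Φ : ℕ → ℝ → ℝ, (∀ N : ℕ, 2 ≤ N → Monotone (Φ N) ∧ (∀ s : ℝ, s ≤ 0 → Φ N s = 0) ∧ (∃ m : ℝ, ∀ s : ℝ, Φ N s ≤ m) ∧ ∀ γ : ℝ, 0 < γ → (∀ (N' : ℕ) (T_L T_R : ℝ), 0 < T_L → 0 < T_R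 → ∀ μ ν : Measur
/-- item stmt-AtomisticToContinuum-15249 · crux · rank 2 · open · by planner
why it might fail: It IS the finiteness content (false at lam=β=0: bounded support ⇒ N·Φ_N(1) ≍ N) and slightly stronger than bounded response: a mass bump of N·μ̂_N at scales 1 ≪ t ≪ N (a band of interior relaxation rates) breaks it while FL survives; C(T) ≳ (lam·T)⁻².
sources: BonettoLebowitzReyBellet2000, AokiLukkarinenSpohn2006, BeckerMenegaki2022, doi:10.1038/srep17506, decl Literature.Barriers.AtomisticToContinuum.HasBoundedResponse
[crux] (U) ANTI-BALLISTIC HALF in contact currency (card K1, upper density): for pinnedChain (all >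
0) and T > 0, for every family of contact distribution functions Φ_N representing the response at
every γ (the data of K2), there are C and N₀ with N·Φ_N(t) ≤ C·(1+t) for all N ≥ N₀ and all t > 0 —
the scaled contact measure N·μ̂_N has O(1) cumulative density at EVERY scale; by the layer-cake form
it gives HasBoundedResponse at every γ (N·G_N(γ) ≤ C·γ·(3+2/γ²+1/γ⁴)·π/2) and it is the conductance
plateau 'G_N(γ) ≈ κ/N for κ/N ≪ γ ≪ N' made uniform. [deps: StieltjesRepresentation] [difficulty:
open-problem] -/
@[route_item "route-AtomisticToContinuum-ContactStieltjesMeasure", crux]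
def ContactUpperDensity : Prop :=
  ∀ ω₂ lam β : ℝ, 0 < ω₂ → 0 < lam → 0 < β → ∀ T : ℝ, 0 < T → ∀ Φ : ℕ → ℝ → ℝ, (∀ N : ℕ, 2 ≤ N → Monotone (Φ N) ∧ (∀ s : ℝ, s ≤ 0 → Φ N s = 0) ∧ (∃ m : ℝ, ∀ s : ℝ, Φ N s ≤ m) ∧ ∀ γ : ℝ, 0 < γ → (∀ (N' : ℕ) (T_L T_R : ℝ), 0 < T_L → 0 < T_R → ∀ μ ν : MeasureTheory.Measure (Literature.MathematicalPhysics.KineticTheory.HeatConduction.PhaseSpace N'), (Literature.MathematicalPhysics.KineticTheory.HeatConduction.pinnedChain ω₂ lam β γ).IsSteadyState N' T_L T_R μ → (Literature.MathematicalPhysics.KineticTheory.HeatConduction.pinnedChain ω₂ lam β γ).IsSteadyState N' T_L T_R ν → μ = ν) → ∀ μ : (N' : ℕ) → ℝ → ℝ → MeasureTheory.Measure (Literature.MathematicalPhysics.KineticTheory.HeatConduction.PhaseSpace N'), (∀ (N' : ℕ) (T_L T_R : ℝ), 0 < T_L → 0 < T_R → (Literature.MathematicalPhysics.KineticTheory.HeatConduction.pinnedChain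 ω₂ lam β γ).IsSteadyState N' T_L T_R (μ N' T_L T_R)) → Filter.Tendsto (fun δ : ℝ => (Literature.MathematicalPhysics.KineticTheory.HeatConduction.pinnedChain ω₂ lam β γ).totalCurrent (μ N (T + δ / 2) (T - δ / 2)) / δ) (nhdsWithin 0 {(0 : ℝ)}ᶜ) (nhds (((N : ℝ) - 1) * γ * ∫ t in Set.Ioi (0 : ℝ), Φ N t * (2 * t / (γ ^ 2 + t ^ 2) ^ 2)))) → ∃ C : ℝ, ∃ N₀ : ℕ, ∀ N : ℕ, N₀ ≤ N → ∀ t : ℝ, 0 < t → (N : ℝ) * Φ N t ≤ C * (1 + t)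

-- earlier StieltjesRepresentation (stmt-AtomisticToContinuum-15172, replaced 2026-08-16T14:54:18Z -> stmt-AtomisticToContinuum-15248): retired by None — ∀ ω₂ lam β : ℝ, 0 < ω₂ → 0 ≤ lam → 0 ≤ β → ∀ T : ℝ, 0 < T → ∃ Φ : ℕ → ℝ → ℝ, ∀ N : ℕ, 2 ≤ N → Monotone (Φ N) ∧ (∀ s : ℝ, s ≤ 0 → Φ N s = 0) ∧ (∃ m : ℝ, ∀ s : ℝ, Φ N s ≤ m) ∧ ∀ γ : ℝ, 0 < γ → (∀ (N' : ℕ) (T_L T_R : ℝ), 0 < T_L → 0 < T_R → ∀ μ ν : Mea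
/-- item stmt-AtomisticToContinuum-15248 · crux · rank 3 · open · by planner
why it might fail: Fixed-N but real: ∂_δJ must equal the L²(μ_T) resolvent form at spectral parameter 0 for EVERY γ>0 (weighted-space ergodic theory of the hypoelliptic generator, core on C_c^∞), uniformly enough for ε→0; KAM-slow isolated-chain structure at small γ could spoil 'D = formula' there.
sources: CuneoEckmannHairerReyBellet2018, Carmona2007, KunduDharNarayan2009, BernardinOlla2011, ReyBellet2003, HairerMajda2009
[crux] (K2) THE REPRESENTATION (card K2 + layer cake), stated for ω₂ > 0, lam ≥ 0, β ≥ 0 (the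
harmonic member INCLUDED: there it is a finite-atom step function, a Lean-sized calibration against
HarmonicChainBallisticFlux) and T > 0: there is a family (Φ_N)_{N≥2} of bounded monotone functions
vanishing on (−∞,0] (the contact distribution functions s ↦ μ̂_N((0,s]), ONE per N) such that for
EVERY friction γ > 0, under weak-NESS uniqueness and for every steady-state family, the response
quotient totalCurrent(μ_{N,T+δ/2,T−δ/2})/δ CONVERGES (δ → 0) to (N−1)·γ·∫₀^∞ Φ_N(t)·2t/(γ²+t²)² dt
(= (N−1)·γ∫dμ̂_N/(γ²+s²)) — existence of the finite-N response (known, KDN/0717) and its Stieltjes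
identification in one clause. Proof core: G_N(γ) = γ/2 − (γ²/4T²)⟨u,(γP+A)⁻¹u⟩, u = p_0² − p²_{N−1};
Sym((γP+A)⁻¹) = γ(γP+A)⁻¹P(γP−A)⁻¹; P_ε = P + εΠ_0, 𝕂_ε = P_ε^{-1/2}AP_ε^{-1/2} skew ⇒
⟨v,(γ+𝕂_ε)⁻¹v⟩ = γ⟨v,(γ²+|𝕂_ε|²)⁻¹v⟩; the constant term 1/2 − ‖P^{-1/2}u‖²/4T² vanishes exactly (Var
p_b² = 2T²); pointwise limits of Stieltjes transforms of fixed mass; μ̂ = s²ρ/4T² kills the atom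
(reflection-odd invariant structure of the isolated chain). [difficulty: L] -/
@[route_item "route-AtomisticToContinuum-ContactStieltjesMeasure", crux]
def StieltjesRepresentation : Prop :=
  ∀ ω₂ lam β : ℝ, 0 < ω₂ → 0 ≤ lam → 0 ≤ β → ∀ T : ℝ, 0 < T → ∃ Φ : ℕ → ℝ → ℝ, ∀ N : ℕ, 2 ≤ N → Monotone (Φ N) ∧ (∀ s : ℝ, s ≤ 0 → Φ N s = 0) ∧ (∃ m : ℝ, ∀ s : ℝ, Φ N s ≤ m) ∧ ∀ γ : ℝ, 0 < γ → (∀ (N' : ℕ) (T_L T_R : ℝ), 0 < T_L → 0 < T_R → ∀ μ ν : MeasureTheory.Measure (Literature.MathematicalPhysics.KineticTheory.HeatConduction.PhaseSpace N'), (Literature.MathematicalPhysics.KineticTheory.HeatConduction.pinnedChain ω₂ lam β γ).IsSteadyState N' T_L T_R μ → (Literature.MathematicalPhysics.KineticTheory.HeatConduction.pinnedChain ω₂ lam β γ).IsSteadyState N' T_L T_R ν → μ = ν) → ∀ μ : (N' : ℕ) → ℝ → ℝ → MeasureTheory.Measure (Literature.MathematicalPhysics.KineticTheory.HeatConduction.PhaseSpace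 N'), (∀ (N' : ℕ) (T_L T_R : ℝ), 0 < T_L → 0 < T_R → (Literature.MathematicalPhysics.KineticTheory.HeatConduction.pinnedChain ω₂ lam β γ).IsSteadyState N' T_L T_R (μ N' T_L T_R)) → Filter.Tendsto (fun δ : ℝ => (Literature.MathematicalPhysics.KineticTheory.HeatConduction.pinnedChain ω₂ lam β γ).totalCurrent (μ N (T + δ / 2) (T - δ / 2)) / δ) (nhdsWithin 0 {(0 : ℝ)}ᶜ) (nhds (((N : ℝ) - 1) * γ * ∫ t in Set.Ioi (0 : ℝ), Φ N t * (2 * t / (γ ^ 2 + t ^ 2) ^ 2)))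

-- earlier ContactMeasureLimit (stmt-AtomisticToContinuum-15173, replaced 2026-08-16T14:54:18Z -> stmt-AtomisticToContinuum-15250): retired by None — ∀ ω₂ lam β : ℝ, 0 < ω₂ → 0 < lam → 0 < β → ∀ T : ℝ, 0 < T → ∀ Φ : ℕ → ℝ → ℝ, (∀ N : ℕ, 2 ≤ N → Monotone (Φ N) ∧ (∀ s : ℝ, s ≤ 0 → Φ N s = 0) ∧ (∃ m : ℝ, ∀ s : ℝ, Φ N s ≤ m) ∧ ∀ γ : ℝ, 0 < γ → (∀ (N' : ℕ) (T_L T_R : ℝ), 0 < T_L → 0 < T_R → ∀ μ ν : Measur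
/-- item stmt-AtomisticToContinuum-15250 · crux · rank 4 · open · by planner
why it might fail: Given K2,(U) it is equivalent to convergence of D_N(γ) for ALL γ at once (Stieltjes–Vitali): the existence clause of FL uniformly in the coupling; two subsequences with different contact profiles (parity in N, an IR edge drifting like (κ/N)·log N) break it.
sources: BonettoLebowitzReyBellet2000, KunduDharNarayan2009, doi:10.1007/BF02099496, Dhar2008
[crux] (M) EXISTENCE HALF in contact currency (card K1, convergence): for every representing family
Φ_N there is a monotone M : ℝ → ℝ with N·Φ_N(t) → M(t) at every continuity point t > 0 of M — the
scaled contact measures N·μ̂_N converge vaguely on (0,∞) (under FL with flat density, M(t) = 2κt/π: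
support ContactEquidistribution). With (U) and K2, dominated convergence gives D_N(γ) →
γ∫₀^∞M(t)·2t/(γ²+t²)²dt for every γ simultaneously. [deps: StieltjesRepresentation] [difficulty:
open-problem] -/
@[route_item "route-AtomisticToContinuum-ContactStieltjesMeasure", crux]
def ContactMeasureLimit : Prop :=
  ∀ ω₂ lam β : ℝ, 0 < ω₂ → 0 < lam → 0 < β → ∀ T : ℝ, 0 < T → ∀ Φ : ℕ → ℝ → ℝ, (∀ N : ℕ, 2 ≤ N → Monotone (Φ N) ∧ (∀ s : ℝ, s ≤ 0 → Φ N s = 0) ∧ (∃ m : ℝ, ∀ s : ℝ, Φ N s ≤ m) ∧ ∀ γ : ℝ, 0 < γ → (∀ (N' : ℕ) (T_L T_R : ℝ), 0 < T_L → 0 < T_R → ∀ μ ν : MeasureTheory.Measure (Literature.MathematicalPhysics.KineticTheory.HeatConduction.PhaseSpace N'), (Literature.MathematicalPhysics.KineticTheory.HeatConduction.pinnedChain ω₂ lam β γ).IsSteadyState N' T_L T_R μ → (Literature.MathematicalPhysics.KineticTheory.HeatConduction.pinnedChain ω₂ lam β γ).IsSteadyState N' T_L T_R ν → μ = ν) →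 ∀ μ : (N' : ℕ) → ℝ → ℝ → MeasureTheory.Measure (Literature.MathematicalPhysics.KineticTheory.HeatConduction.PhaseSpace N'), (∀ (N' : ℕ) (T_L T_R : ℝ), 0 < T_L → 0 < T_R → (Literature.MathematicalPhysics.KineticTheory.HeatConduction.pinnedChain ω₂ lam β γ).IsSteadyState N' T_L T_R (μ N' T_L T_R)) → Filter.Tendsto (fun δ : ℝ => (Literature.MathematicalPhysics.KineticTheory.HeatConduction.pinnedChain ω₂ lam β γ).totalCurrent (μ N (T + δ / 2) (T - δ / 2)) / δ) (nhdsWithin 0 {(0 : ℝ)}ᶜ) (nhds (((N : ℝ) - 1) * γ * ∫ t in Set.Ioi (0 : ℝ), Φ N t * (2 * t / (γ ^ 2 + t ^ 2) ^ 2)))) → ∃ M : ℝ → ℝ, Monotone M ∧ ∀ t : ℝ, 0 < t → ContinuousAt M t → Filter.Tendsto (fun N : ℕ => (N : ℝ) * Φ N t) Filter.atTop (nhds (M t))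

/-- item stmt-AtomisticToContinuum-11749 · crux · rank 5 · open · by planner
why it might fail: No N-uniform lower bound on the NESS current of a deterministic anharmonic chain is in print; asymptotic localisation (DeRoeckHuveneers2015) makes c(T) super-polynomially small at large lam·T; in contact currency all mass may escape to s ≫ N.
sources: DeRoeckHuveneers2015, BonettoLebowitzReyBellet2000, BernardinOlla2011, Dhar2008
[crux] under weak-NESS uniqueness, for every steady-state family of pinnedChain ω₂ lam β γ (all >
0), T > 0 and the response coefficients D_N: ∃ c = c(ω₂,lam,β,γ,T) > 0 and N₁ with D_N ≥ c for all N
≥ N₁ (liminf_N D_N > 0; an Ohmic LOWER bound J_N ≥ c·δT/(N−1) to first order; card item K3's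
positivity half). NECESSARY for the conjunct (D_N → κ(T) > 0). In the glue it caps the Fekete slope
(R_N/N ≤ 1/c), i.e. κ ≥ c. No N-uniform lower bound on the NESS current of a deterministic
anharmonic chain is in print; candidate engines: linear-response fluctuation-theorem / uncertainty
bounds, comparison with the energy-conserving-noise chain where κ ≥ c is a theorem
(BernardinOlla2005, BasileBernardinOlla2009), multi-scale pigeonhole on the response temperature
profile (card anti-insulator-kink-rigidity); ALTERNATIVE SUPPLIER: the companion SUBadditive half
(card fekete-resistance-subadditivity: R_{N+M} ≤ R_N + R_M + C' and D_2 > 0 give R_N ≤ K·N, hence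
D_N ≥ 1/(2K)). [difficulty: XL] -/
@[route_item "route-AtomisticToContinuum-ContactStieltjesMeasure", crux]
def ConductanceLowerBound : Prop :=
  ∀ ω₂ lam β γ : ℝ, 0 < ω₂ → 0 < lam → 0 < β → 0 < γ → (∀ (N : ℕ) (T_L T_R : ℝ), 0 < T_L → 0 < T_R → ∀ μ ν : MeasureTheory.Measure (Literature.MathematicalPhysics.KineticTheory.HeatConduction.PhaseSpace N), (Literature.MathematicalPhysics.KineticTheory.HeatConduction.pinnedChain ω₂ lam β γ).IsSteadyState N T_L T_R μ → (Literature.MathematicalPhysics.KineticTheory.HeatConduction.pinnedChain ω₂ lam β γ).IsSteadyState N T_L T_R ν → μ = ν) → ∀ μ : (N : ℕ) → ℝ → ℝ → MeasureTheory.Measure (Literature.MathematicalPhysics.KineticTheory.HeatConduction.PhaseSpace N), (∀ (N : ℕ) (T_L T_R : ℝ), 0 < T_L → 0 < T_R → (Literature.MathematicalPhysics.KineticTheory.HeatConduction.pinnedChain ω₂ lam β γ).IsSteadyState N T_L T_R (μ N T_L T_R)) → ∀ T : ℝ, 0 < T → ∀ D : ℕ → ℝ, (∀ N : ℕ, Filter.Tendsto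 (fun δ : ℝ => (Literature.MathematicalPhysics.KineticTheory.HeatConduction.pinnedChain ω₂ lam β γ).totalCurrent (μ N (T + δ / 2) (T - δ / 2)) / δ) (nhdsWithin 0 {(0 : ℝ)}ᶜ) (nhds (D N))) → ∃ c : ℝ, 0 < c ∧ ∃ N₁ : ℕ, ∀ N : ℕ, N₁ ≤ N → c ≤ D N

/-- item stmt-AtomisticToContinuum-15180 · support · rank 9 · open · by planner
sources: BonettoLebowitzReyBellet2000, RiederLebowitzLieb1967, doi:10.1038/srep17506
[support] FINITE-N COROLLARY of the K2 construction (card P1), N-uniform and new, stated for lam, β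
≥ 0: for all N ≥ 2, T > 0 and EVERY γ > 0, G_N(γ) = D_N/(N−1) ≤ γm/(γ²+2m) (≤ ¼√(2m) =
¼√E[U″(q_0)+V″(q_1−q_0)], coupling-free), with m := ½E_{μ_T}[U″(q_0)+V″(q_1−q_0)] = ½E[ω₂+3lam
q_0²+1+3β(q_1−q_0)²] (mass of μ̂_N ≤ m by ‖𝕂v‖² = 2T E F_0² and Gibbs integration by parts; ∫dμ̂/s²
≤ ½; two-constraint Chebyshev bound with tangent at s² = 2m). Checked against the harmonic dimer:
γ/(2+4γ²) ≤ γ/(γ²+2) at ω₂ = 1. A refutable N-uniform inequality that is false for no known chain;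
Lean-provable once the (S)-construction lands. [difficulty: M] -/
@[route_item "route-AtomisticToContinuum-ContactStieltjesMeasure"]
def CouplingFreeCeiling : Prop :=
  ∀ ω₂ lam β γ : ℝ, 0 < ω₂ → 0 ≤ lam → 0 ≤ β → 0 < γ → ∀ T : ℝ, 0 < T → ∀ (N : ℕ) (hN : 2 ≤ N), (∀ (N' : ℕ) (T_L T_R : ℝ), 0 < T_L → 0 < T_R → ∀ μ ν : MeasureTheory.Measure (Literature.MathematicalPhysics.KineticTheory.HeatConduction.PhaseSpace N'), (Literature.MathematicalPhysics.KineticTheory.HeatConduction.pinnedChain ω₂ lam β γ).IsSteadyState N' T_L T_R μ → (Literature.MathematicalPhysics.KineticTheory.HeatConduction.pinnedChain ω₂ lam β γ).IsSteadyState N' T_L T_R ν → μ = ν) → ∀ μ : (N' : ℕ) → ℝ → ℝ → MeasureTheory.Measure (Literature.MathematicalPhysics.KineticTheory.HeatConduction.PhaseSpace N'), (∀ (N' : ℕ) (T_L T_R : ℝ), 0 < T_L → 0 < T_R → (Literature.MathematicalPhysics.KineticTheory.HeatConduction.pinnedChain ω₂ lam β γ).IsSteadyState N' T_L T_R (μ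 N' T_L T_R)) → ∀ D : ℝ, Filter.Tendsto (fun δ : ℝ => (Literature.MathematicalPhysics.KineticTheory.HeatConduction.pinnedChain ω₂ lam β γ).totalCurrent (μ N (T + δ / 2) (T - δ / 2)) / δ) (nhdsWithin 0 {(0 : ℝ)}ᶜ) (nhds D) → let m : ℝ := (1 / 2) * ∫ x, (ω₂ + 3 * lam * (x.1 ⟨0, by omega⟩) ^ 2 + (1 + 3 * β * (x.1 ⟨1, by omega⟩ - x.1 ⟨0, by omega⟩) ^ 2)) ∂((Literature.MathematicalPhysics.KineticTheory.HeatConduction.pinnedChain ω₂ lam β γ).gibbsMeasure N T); D / ((N : ℝ) - 1) ≤ γ * m / (γ ^ 2 + 2 * m)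

-- earlier ContactEquidistribution (stmt-AtomisticToContinuum-15176, replaced 2026-08-16T14:54:18Z -> stmt-AtomisticToContinuum-15251): retired by None — ∀ ω₂ lam β : ℝ, 0 < ω₂ → 0 < lam → 0 < β → ∀ T : ℝ, 0 < T → ∀ Φ : ℕ → ℝ → ℝ, (∀ N : ℕ, 2 ≤ N → Monotone (Φ N) ∧ (∀ s : ℝ, s ≤ 0 → Φ N s = 0) ∧ (∃ m : ℝ, ∀ s : ℝ, Φ N s ≤ m) ∧ ∀ γ : ℝ, 0 < γ → (∀ (N' : ℕ) (T_L T_R : ℝ), 0 < T_L → 0 < T_R → ∀ μ ν : Me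
/-- item stmt-AtomisticToContinuum-15251 · support · rank 9 · open · by planner
sources: BonettoLebowitzReyBellet2000, doi:10.1007/BF02099496, doi:10.1038/srep17506
[support] THE SHARP FORM (card K1 verbatim: equidistribution): for every representing family,
N·Φ_N(t) → (2κ/π)·t for all t > 0 with some κ > 0 — the scaled contact measures converge vaguely to
(2κ/π)·Lebesgue; implies (M) with M(t) = 2κt/π and, with (U), FouriersLaw with a γ-INDEPENDENT κ
(γ∫(2κ/π)ds/(γ²+s²) = κ); not a hypothesis of `closes` (the Statement lets κ depend on γ), filed for
provers/refuters of the flat-density prediction. [difficulty: open-problem] -/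
@[route_item "route-AtomisticToContinuum-ContactStieltjesMeasure"]
def ContactEquidistribution : Prop :=
  ∀ ω₂ lam β : ℝ, 0 < ω₂ → 0 < lam → 0 < β → ∀ T : ℝ, 0 < T → ∀ Φ : ℕ → ℝ → ℝ, (∀ N : ℕ, 2 ≤ N → Monotone (Φ N) ∧ (∀ s : ℝ, s ≤ 0 → Φ N s = 0) ∧ (∃ m : ℝ, ∀ s : ℝ, Φ N s ≤ m) ∧ ∀ γ : ℝ, 0 < γ → (∀ (N' : ℕ) (T_L T_R : ℝ), 0 < T_L → 0 < T_R → ∀ μ ν : MeasureTheory.Measure (Literature.MathematicalPhysics.KineticTheory.HeatConduction.PhaseSpace N'), (Literature.MathematicalPhysics.KineticTheory.HeatConduction.pinnedChain ω₂ lam β γ).IsSteadyState N' T_L T_R μ → (Literature.MathematicalPhysics.KineticTheory.HeatConduction.pinnedChain ω₂ lam β γ).IsSteadyState N' T_L T_R ν → μ = ν) → ∀ μ : (N' : ℕ) → ℝ → ℝ → MeasureTheory.Measure (Literature.MathematicalPhysics.KineticTheory.HeatConduction.PhaseSpace N'), (∀ (N' : ℕ) (T_L T_R : ℝ), 0 <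 T_L → 0 < T_R → (Literature.MathematicalPhysics.KineticTheory.HeatConduction.pinnedChain ω₂ lam β γ).IsSteadyState N' T_L T_R (μ N' T_L T_R)) → Filter.Tendsto (fun δ : ℝ => (Literature.MathematicalPhysics.KineticTheory.HeatConduction.pinnedChain ω₂ lam β γ).totalCurrent (μ N (T + δ / 2) (T - δ / 2)) / δ) (nhdsWithin 0 {(0 : ℝ)}ᶜ) (nhds (((N : ℝ) - 1) * γ * ∫ t in Set.Ioi (0 : ℝ), Φ N t * (2 * t / (γ ^ 2 + t ^ 2) ^ 2)))) → ∃ κ : ℝ, 0 < κ ∧ ∀ t : ℝ, 0 < t → Filter.Tendsto (fun N : ℕ => (N : ℝ) * Φ N t) Filter.atTop (nhds (2 * κ / Real.pi * t))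

-- earlier Assembly (stmt-AtomisticToContinuum-15181, replaced 2026-08-16T14:54:18Z -> stmt-AtomisticToContinuum-15252): retired by None — NessUnique → FiniteResponseOfUnique → StieltjesRepresentation → ContactUpperDensity → ContactMeasureLimit → ConductanceLowerBound → FouriersLaw
/-- item stmt-AtomisticToContinuum-15252 · assembly · rank 1 · open · by planner
sources: BonettoLebowitzReyBellet2000, KunduDharNarayan2009
[assembly] StieltjesRepresentation → ContactUpperDensity → ContactMeasureLimit →
ConductanceLowerBound → FouriersLaw (the sub-problem Statement `_root_.FouriersLaw`, by name);
literally the type of the proved crux-only deciding theorem `closes`. -/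
@[route_item "route-AtomisticToContinuum-ContactStieltjesMeasure"]
def Assembly : Prop :=
  StieltjesRepresentation → ContactUpperDensity → ContactMeasureLimit → ConductanceLowerBound → FouriersLaw

/-! D-0027 §2.1 — DECIDING THEOREM (planner-authored via `route open/edit --closes-file`; by planner-plan-novel-AtomisticToContinuum-Fourier-51cdba3b-g2- 2026-08-16T14:54:18Z):
its hypotheses are this route's items and its conclusion the sub-problem Statement (glue_lint), and it elaborates with this file. -/

/-- D-0027 §2.1 DECIDING THEOREM of route ContactStieltjesMeasure (card contact-stieltjes-foster-equidistribution), crux-only.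
Clause (i): proved `pinnedChain_exists_isSteadyState` + proved `nessUnique_proof` (stmt-0741). Clause (ii): `D_N := (N-1)γ∫₀^∞ Φ_N w_γ`
(`N ≥ 2`, its limit statement is `StieltjesRepresentation`; `0` for `N ≤ 1`, no bonds), `w_γ(t) = 2t/(γ²+t²)²`; dominated convergence
(majorant `C(1+t)w_γ ≤ C(3+2/γ²+1/γ⁴)(1+t²)⁻¹` from `ContactUpperDensity`, a.e. limit off the countable jump set of the monotone `M` of
`ContactMeasureLimit`) gives `D_N → γ∫₀^∞ M w_γ =: κ(T)`, positive by `ConductanceLowerBound`; uniqueness transfers the `δ`-limits. -/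
@[closes "route-AtomisticToContinuum-ContactStieltjesMeasure"] theorem closes (hRep : StieltjesRepresentation) (hUD : ContactUpperDensity)
    (hLim : ContactMeasureLimit) (hP : ConductanceLowerBound) : _root_.FouriersLaw := by
  -- crux-only hypotheses (D-0027 §2.1): weak-NESS uniqueness (stmt-0741) is PROVED in the tree and invoked here;
  have hU : Summit.AtomisticToContinuum.FouriersLaw.Theses.EmbeddedDrudeMourre.NessUnique :=
    Summit.AtomisticToContinuum.FouriersLaw.Theorems.nessUnique_proof
  intro ω₂ lam β γ hω hl hβ hγ
  have huniq := hU ω₂ lam β γ hω hl hβ hγ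
  have hex := fun (N : ℕ) (T_L T_R : ℝ) (hL : 0 < T_L) (hR : 0 < T_R) =>
    Literature.MathematicalPhysics.KineticTheory.HeatConduction.pinnedChain_exists_isSteadyState hω hl hβ hγ N hL hR
  refine ⟨fun N T_L T_R hL hR => ?_, ?_⟩
  ·
    obtain ⟨μ, hμ⟩ := hex N T_L T_R hL hR
    exact ⟨μ, hμ, fun ν hν => huniq N T_L T_R hL hR ν μ hν hμ⟩
  classical
  let μ₀ : (N : ℕ) → ℝ → ℝ →
      MeasureTheory.Measure (Literature.MathematicalPhysics.KineticTheory.HeatConduction.PhaseSpace N) :=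
    fun N T_L T_R => if h : 0 < T_L ∧ 0 < T_R then Classical.choose (hex N T_L T_R h.1 h.2) else 0
  have hμ₀ : ∀ (N : ℕ) (T_L T_R : ℝ), 0 < T_L → 0 < T_R →
      (Literature.MathematicalPhysics.KineticTheory.HeatConduction.pinnedChain ω₂ lam β γ).IsSteadyState N T_L T_R
        (μ₀ N T_L T_R) := by
    intro N T_L T_R hL hR
    simp only [μ₀, dif_pos (And.intro hL hR)]
    exact Classical.choose_spec (hex N T_L T_R hL hR)
  have hγ2 : 0 < γ ^ 2 := by positivity
  have hden : ∀ t : ℝ, 0 < (γ ^ 2 + t ^ 2) ^ 2 := fun t => by positivity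
  have hw_nonneg : ∀ t : ℝ, 0 ≤ t → 0 ≤ 2 * t / (γ ^ 2 + t ^ 2) ^ 2 := fun t ht =>
    div_nonneg (by linarith) (hden t).le
  have hw_cont : Continuous fun t : ℝ => 2 * t / (γ ^ 2 + t ^ 2) ^ 2 := by
    refine Continuous.div (by fun_prop) (by fun_prop) fun t => (hden t).ne'
  have hmaj : ∀ t : ℝ, 0 ≤ t →
      (1 + t) * (2 * t / (γ ^ 2 + t ^ 2) ^ 2) ≤ (3 + 2 / γ ^ 2 + 1 / γ ^ 4) * (1 + t ^ 2)⁻¹ := by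
    intro t ht
    have h1 : 0 < 1 + t ^ 2 := by positivity
    have hg4 : 0 < γ ^ 4 := by positivity
    rw [mul_div_assoc', div_le_iff₀ (hden t), mul_assoc, inv_mul_eq_div, mul_div_assoc',
      le_div_iff₀ h1]
    have hK : (3 + 2 / γ ^ 2 + 1 / γ ^ 4) = (3 * γ ^ 4 + 2 * γ ^ 2 + 1) / γ ^ 4 := by
      field_simp
    rw [hK, div_mul_eq_mul_div, le_div_iff₀ hg4]
    have e1 : 2 * t ≤ 1 + t ^ 2 := by nlinarith [sq_nonneg (t - 1)]
    have e2 : 2 * t ^ 3 ≤ t ^ 2 + t ^ 4 := by nlinarith [sq_nonneg (t - 1), sq_nonneg t]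
    have lhs : (1 + t) * (2 * t) * (1 + t ^ 2) ≤ 3 * t ^ 4 + 4 * t ^ 2 + 1 := by nlinarith [e1, e2]
    have rhs : (3 * t ^ 4 + 4 * t ^ 2 + 1) * γ ^ 4 ≤ (3 * γ ^ 4 + 2 * γ ^ 2 + 1) * (γ ^ 2 + t ^ 2) ^ 2 := by
      nlinarith [sq_nonneg (γ * t), sq_nonneg γ, sq_nonneg t, mul_nonneg hγ2.le (sq_nonneg t),
        mul_nonneg (mul_nonneg hγ2.le hγ2.le) (sq_nonneg t), pow_nonneg (sq_nonneg t) 2,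
        mul_nonneg hγ2.le (pow_nonneg (sq_nonneg t) 2)]
    calc (1 + t) * (2 * t) * (1 + t ^ 2) * γ ^ 4 ≤ (3 * t ^ 4 + 4 * t ^ 2 + 1) * γ ^ 4 :=
          mul_le_mul_of_nonneg_right lhs hg4.le
      _ ≤ (3 * γ ^ 4 + 2 * γ ^ 2 + 1) * (γ ^ 2 + t ^ 2) ^ 2 := rhs
  have key : ∀ T : ℝ, 0 < T → ∃ κT : ℝ, 0 < κT ∧ ∃ D : ℕ → ℝ,
      (∀ N : ℕ, Filter.Tendsto (fun δ : ℝ =>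
        (Literature.MathematicalPhysics.KineticTheory.HeatConduction.pinnedChain ω₂ lam β γ).totalCurrent
          (μ₀ N (T + δ / 2) (T - δ / 2)) / δ) (nhdsWithin 0 {(0 : ℝ)}ᶜ) (nhds (D N))) ∧
      Filter.Tendsto D Filter.atTop (nhds κT) := by
    intro T hT
    obtain ⟨Φ, hΦ⟩ := hRep ω₂ lam β hω hl.le hβ.le T hT
    let D : ℕ → ℝ := fun N => if 2 ≤ N then
      ((N : ℝ) - 1) * γ * ∫ t in Set.Ioi (0 : ℝ), Φ N t * (2 * t / (γ ^ 2 + t ^ 2) ^ 2) else 0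
    have hDN : ∀ N : ℕ, 2 ≤ N →
        D N = ((N : ℝ) - 1) * γ * ∫ t in Set.Ioi (0 : ℝ), Φ N t * (2 * t / (γ ^ 2 + t ^ 2) ^ 2) :=
      fun N hN => if_pos hN
    have hD : ∀ N : ℕ, Filter.Tendsto (fun δ : ℝ =>
        (Literature.MathematicalPhysics.KineticTheory.HeatConduction.pinnedChain ω₂ lam β γ).totalCurrent
          (μ₀ N (T + δ / 2) (T - δ / 2)) / δ) (nhdsWithin 0 {(0 : ℝ)}ᶜ) (nhds (D N)) := by
      intro N
      by_cases hN : 2 ≤ N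
      · rw [hDN N hN]
        exact (hΦ N hN).2.2.2 γ hγ huniq μ₀ hμ₀
      ·
        have hD0 : D N = 0 := if_neg hN
        rw [hD0]
        have hj : ∀ (i : Fin N) (x : Literature.MathematicalPhysics.KineticTheory.HeatConduction.PhaseSpace N),
            (Literature.MathematicalPhysics.KineticTheory.HeatConduction.pinnedChain ω₂ lam β γ).bondCurrent N i x = 0 :=
          fun i x => by
            unfold Literature.MathematicalPhysics.KineticTheory.HeatConduction.OscillatorChain.bondCurrent
            refine Finset.sum_eq_zero fun j _ => ?_
            have hji : ¬ (j.val = i.val + 1) := by have := j.isLt; omega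
            rw [if_neg hji]
        have e : (fun δ : ℝ =>
            (Literature.MathematicalPhysics.KineticTheory.HeatConduction.pinnedChain ω₂ lam β γ).totalCurrent
              (μ₀ N (T + δ / 2) (T - δ / 2)) / δ) = fun _ => 0 := by
          funext δ
          have : (Literature.MathematicalPhysics.KineticTheory.HeatConduction.pinnedChain ω₂ lam β γ).totalCurrent
              (μ₀ N (T + δ / 2) (T - δ / 2)) = 0 := by
            unfold Literature.MathematicalPhysics.KineticTheory.HeatConduction.OscillatorChain.totalCurrent
            exact Finset.sum_eq_zero fun i _ => by simp only [hj, MeasureTheory.integral_zero]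
          rw [this, zero_div]
        rw [e]
        exact tendsto_const_nhds
    obtain ⟨C, N₀, hC⟩ := hUD ω₂ lam β hω hl hβ T hT Φ hΦ
    obtain ⟨M, hMmono, hM⟩ := hLim ω₂ lam β hω hl hβ T hT Φ hΦ
    have hΦ_nonneg : ∀ N : ℕ, 2 ≤ N → ∀ t : ℝ, 0 ≤ t → 0 ≤ Φ N t := by
      intro N hN t ht
      have h0 : Φ N 0 = 0 := (hΦ N hN).2.1 0 le_rfl
      simpa [h0] using (hΦ N hN).1 ht
    have hC_nonneg : 0 ≤ C := by
      have h := hC (max N₀ 2) (le_max_left _ _) 1 one_pos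
      have h' : 0 ≤ ((max N₀ 2 : ℕ) : ℝ) * Φ (max N₀ 2) 1 :=
        mul_nonneg (Nat.cast_nonneg _) (hΦ_nonneg _ (le_max_right _ _) 1 zero_le_one)
      linarith
    set L : ℝ := ∫ t in Set.Ioi (0 : ℝ), M t * (2 * t / (γ ^ 2 + t ^ 2) ^ 2) with hL
    have hDCT : Filter.Tendsto (fun N : ℕ => ∫ t in Set.Ioi (0 : ℝ),
        ((N : ℝ) * Φ N t) * (2 * t / (γ ^ 2 + t ^ 2) ^ 2)) Filter.atTop (nhds L) := by
      refine MeasureTheory.tendsto_integral_filter_of_dominated_convergence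
        (fun t => C * (1 + t) * (2 * t / (γ ^ 2 + t ^ 2) ^ 2)) ?_ ?_ ?_ ?_
      ·
        refine Filter.eventually_atTop.2 ⟨2, fun N hN => ?_⟩
        exact ((measurable_const.mul (hΦ N hN).1.measurable).mul hw_cont.measurable).aestronglyMeasurable
      ·
        refine Filter.eventually_atTop.2 ⟨max N₀ 2, fun N hN => ?_⟩
        refine (MeasureTheory.ae_restrict_iff' measurableSet_Ioi).2 (Filter.Eventually.of_forall fun t ht => ?_)
        have ht : 0 < t := ht
        have h1 : 0 ≤ (N : ℝ) * Φ N t :=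
          mul_nonneg (Nat.cast_nonneg _) (hΦ_nonneg N (le_trans (le_max_right _ _) hN) t ht.le)
        rw [Real.norm_eq_abs, abs_of_nonneg (mul_nonneg h1 (hw_nonneg t ht.le))]
        exact mul_le_mul_of_nonneg_right (hC N (le_trans (le_max_left _ _) hN) t ht) (hw_nonneg t ht.le)
      ·
        have hKint : MeasureTheory.Integrable (fun t : ℝ => (C * (3 + 2 / γ ^ 2 + 1 / γ ^ 4)) * (1 + t ^ 2)⁻¹)
            (MeasureTheory.volume.restrict (Set.Ioi (0 : ℝ))) :=
          (integrable_inv_one_add_sq.const_mul _).integrableOn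
        refine hKint.mono' ?_ ?_
        · exact (Continuous.mul (by fun_prop) hw_cont).aestronglyMeasurable
        · refine (MeasureTheory.ae_restrict_iff' measurableSet_Ioi).2 (Filter.Eventually.of_forall fun t ht => ?_)
          have ht : 0 < t := ht
          have hnn : 0 ≤ C * (1 + t) * (2 * t / (γ ^ 2 + t ^ 2) ^ 2) :=
            mul_nonneg (mul_nonneg hC_nonneg (by linarith)) (hw_nonneg t ht.le)
          rw [Real.norm_eq_abs, abs_of_nonneg hnn, mul_assoc, mul_assoc]
          exact mul_le_mul_of_nonneg_left (hmaj t ht.le) hC_nonneg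
      ·
        have hS : MeasureTheory.volume {t : ℝ | ¬ContinuousAt M t} = 0 :=
          hMmono.countable_not_continuousAt.measure_zero _
        have hae : ∀ᵐ t ∂(MeasureTheory.volume.restrict (Set.Ioi (0 : ℝ))), ContinuousAt M t := by
          refine MeasureTheory.ae_restrict_of_ae ?_
          rw [MeasureTheory.ae_iff]
          simpa using hS
        filter_upwards [hae, MeasureTheory.ae_restrict_mem measurableSet_Ioi] with t hcont ht
        exact (hM t ht hcont).mul_const _
    have hfrac : Filter.Tendsto (fun N : ℕ => ((N : ℝ) - 1) / N) Filter.atTop (nhds 1) := by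
      have h : Filter.Tendsto (fun N : ℕ => (1 : ℝ) - 1 / (N : ℝ)) Filter.atTop (nhds (1 - 0)) :=
        tendsto_const_nhds.sub tendsto_one_div_atTop_nhds_zero_nat
      rw [sub_zero] at h
      refine h.congr' ?_
      filter_upwards [Filter.eventually_gt_atTop 0] with N hN
      have hN' : (N : ℝ) ≠ 0 := by exact_mod_cast hN.ne'
      field_simp
    have hDlim : Filter.Tendsto D Filter.atTop (nhds (γ * (1 * L))) := by
      have h := (tendsto_const_nhds (x := γ)).mul (hfrac.mul hDCT)
      refine h.congr' ?_
      filter_upwards [Filter.eventually_ge_atTop 2] with N hN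
      have hN' : (N : ℝ) ≠ 0 := by
        have : (2 : ℝ) ≤ N := by exact_mod_cast hN
        linarith
      rw [hDN N hN]
      have hfun : (fun t : ℝ => (N : ℝ) * Φ N t * (2 * t / (γ ^ 2 + t ^ 2) ^ 2)) =
          fun t : ℝ => (N : ℝ) * (Φ N t * (2 * t / (γ ^ 2 + t ^ 2) ^ 2)) := by
        funext t; ring
      rw [hfun, MeasureTheory.integral_const_mul]
      generalize (∫ t in Set.Ioi (0 : ℝ), Φ N t * (2 * t / (γ ^ 2 + t ^ 2) ^ 2)) = I
      have hI : ((N : ℝ) - 1) / N * ((N : ℝ) * I) = ((N : ℝ) - 1) * I := by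
        field_simp
      rw [hI]
      ring
    have hγL : γ * (1 * L) = γ * L := by ring
    rw [hγL] at hDlim
    obtain ⟨c, hc, N₁, hN₁⟩ := hP ω₂ lam β γ hω hl hβ hγ huniq μ₀ hμ₀ T hT D hD
    have hcL : c ≤ γ * L := ge_of_tendsto hDlim (Filter.eventually_atTop.2 ⟨N₁, hN₁⟩)
    exact ⟨γ * L, lt_of_lt_of_le hc hcL, D, hD, hDlim⟩
  choose κf hκpos Df hDf hDlim using key
  refine ⟨fun T => if hT : 0 < T then κf T hT else 1, fun T hT => ?_, ?_⟩
  · simp only [dif_pos hT]; exact hκpos T hT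
  intro μ hμ T hT
  refine ⟨Df T hT, fun N => ?_, ?_⟩
  ·
    refine (hDf T hT N).congr' ?_
    have h2 : ∀ᶠ δ in nhds (0 : ℝ), δ < 2 * T := eventually_lt_nhds (by linarith)
    have h2' : ∀ᶠ δ in nhds (0 : ℝ), -(2 * T) < δ := eventually_gt_nhds (by linarith)
    filter_upwards [mem_nhdsWithin_of_mem_nhds h2, mem_nhdsWithin_of_mem_nhds h2'] with δ hlt hgt
    have ha : 0 < T + δ / 2 := by linarith
    have hb : 0 < T - δ / 2 := by linarith
    rw [huniq N _ _ ha hb (μ₀ N _ _) (μ N _ _) (hμ₀ N _ _ ha hb) (hμ N _ _ ha hb)]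
  · simp only [dif_pos hT]; exact hDlim T hT

end Summit.AtomisticToContinuum.FouriersLaw.Theses.ContactStieltjesMeasure
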